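import Literature.NumberTheory.EllipticCurves.ZpExtensionEisensteinReadoutScalarCompatProofs
import Literature.NumberTheory.GaloisCohomology.Howard2004.SelmerAScalarStabilityProofs
import Literature.NumberTheory.EllipticCurves.IwasawaGeneratorChangeProofs
import HarnessLib

/-!
# The readout of `H¹_F(K, A_𝔮)` is stable under the conjugation action of `Γ_K` on `H¹(K_∞, E[p^∞])` (proofs file)

Topic `NumberTheory/EllipticCurves` (cell `pub/bsd-print-x9`, blueprint HOME/p2/S1-DISCRETE-CONTROL §2, the
reduction of the Selmer conditions «at every conjugate `conj_σ`» to the chosen places; sequel to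
`ZpExtensionEisensteinReadoutScalarCompatProofs` ((B3): `[X] ↦ conj_γ − 1`), `Howard2004/SelmerAScalarStabilityProofs`
((DG1): `H¹_F(K, A)` is `S_m`-stable on representatives) and `IwasawaGeneratorChangeProofs` (`conj_σ = conj_{γ^n}` on
each class of `H¹(K_∞, E[p^∞])`)). THEOREMS ONLY; no definition, no named fact, no instance, no `sorry`.

* `WeierstrassCurve.conjH1_mem_of_conjH1_generator_mem` — a subgroup of `H¹(K_∞, E[p^∞])` stable under `conj_γ`
  for a topological generator `γ` is stable under every `conj_σ` (the tree's `exists_conjH1_eq_conjH1_pow`,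
  `IwasawaGeneratorChangeProofs`: `conj_σ = conj_{γ^n}` on each class);
* `WeierstrassCurve.conjH1_eisensteinTowerReadout_of` — `conj_γ (readout [c]) = readout [c] + readout [[X] • c]`;
* **`WeierstrassCurve.conjH1_mem_map_eisensteinTowerReadout_selmerA`** — for a tower Selmer structure `F` stable
  under the `S_m`-action (`hsmul`, = `SatisfiesH.cond_smul`), the image `readout (H¹_F(K, A_𝔮)) ≤ H¹(K_∞, E[p^∞])` is
  stable under `conj_σ` for EVERY `σ ∈ Γ_K`.  Consequently the Selmer conditions of `Sel_{p^∞}(E/K_∞)`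
  (`selmerGroupOver`: `conj_σ c ∈ localKerOver` for all `σ` and all places) need only be checked at `σ = 1` on this
  image ((B4) of the discrete half of `stub_controlGlue`).

References: [Howard2004HeegnerKolyvagin] §2.2, proof of Thm. 2.2.10; [GreenbergLNM1716] §1 (pp. 59–60: the action of
`Γ` on `H¹(F_∞, E[p^∞])`), §4 p. 98; [NeukirchSchmidtWingberg2008] I §5.  BSD is not proved by any of this.
-/

noncomputable section

open scoped Classical

open Literature.NumberTheory.EllipticCurves Literature.NumberTheory.GaloisRepresentations Field
open Literature.NumberTheory.GaloisRepresentations.galoisCohomology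
open Literature.NumberTheory.GaloisRepresentations.DiscreteGaloisModule (SelmerStructure)
open Literature.NumberTheory.GaloisCohomology.Howard2004

namespace WeierstrassCurve

/-! ## §1 `conj_γ`-stable subgroups are `Γ_K`-stable -/

section ConjPow

universe u

variable {K : Type u} [Field K] [NumberField K] (W : WeierstrassCurve K) {p : ℕ} [hp : Fact p.Prime]
  (κ : ZpExtension K p)

/-- A subgroup of `H¹(K_∞, E[p^∞])` stable under `conj_γ` for a topological generator `γ` is stable under every
`conj_σ`, `σ ∈ Γ_K`. [cite: GreenbergLNM1716, §1 (p. 60)] -/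
theorem conjH1_mem_of_conjH1_generator_mem {γ : absoluteGaloisGroup K} (hγ : κ.IsTopGenerator γ)
    (R : AddSubgroup (W.subgroupH1 p κ.kerSubgroup))
    (hR : ∀ c ∈ R, W.conjH1 p κ.kerSubgroup γ c ∈ R) (σ : absoluteGaloisGroup K) {c : W.subgroupH1 p κ.kerSubgroup}
    (hc : c ∈ R) : W.conjH1 p κ.kerSubgroup σ c ∈ R := by
  obtain ⟨n, hn⟩ := W.exists_conjH1_eq_conjH1_pow κ (show κ γ = Multiplicative.ofAdd 1 from hγ) isUnit_one σ c
  rw [hn]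
  clear hn
  induction n with
  | zero => rwa [pow_zero, W.conjH1_one_holds p κ.kerSubgroup, AddMonoidHom.id_apply]
  | succ n ih =>
    rw [pow_succ', W.conjH1_mul_holds p κ.kerSubgroup, AddMonoidHom.comp_apply]
    exact hR _ ih

end ConjPow

/-! ## §2 The readout of `H¹_F(K, A_𝔮)` is `Γ_K`-stable -/

section Readout

open Literature.NumberTheory.EllipticCurves.ZpExtension (EisensteinLevel)

variable {K : Type} [Field K] [NumberField K] (W : WeierstrassCurve ℚ) [W.IsElliptic] {p : ℕ} [hp : Fact p.Prime]
  (κ : ZpExtension K p) {m : ℕ} (hm : 1 ≤ m)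

variable (π : IwasawaAlgebra p ⧸ Ideal.span {(PowerSeries.X ^ m + PowerSeries.C (p : ℤ_[p]) : IwasawaAlgebra p)})
  (e : ℕ → ℕ)
  (hkill : letI := IwasawaAlgebra.isLocalRing_quotient_X_pow_add_C p hm
    ∀ k, ∀ r ∈ IsLocalRing.maximalIdeal
      (IwasawaAlgebra p ⧸ Ideal.span {(PowerSeries.X ^ m + PowerSeries.C (p : ℤ_[p]) : IwasawaAlgebra p)}) ^ e k,
      ∀ x : EisensteinLevel p m (fun j ↦ geomTorsion (W.baseChange K) ((p : ℤ) ^ j)) (k + 1), r • x = 0)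
  (hker : letI := IwasawaAlgebra.isLocalRing_quotient_X_pow_add_C p hm
    ∀ k, LinearMap.ker ((W.eisensteinTower (κ.unitTwist (-1)) hm).red k) =
      (IsLocalRing.maximalIdeal
        (IwasawaAlgebra p ⧸ Ideal.span {(PowerSeries.X ^ m + PowerSeries.C (p : ℤ_[p]) : IwasawaAlgebra p)}) ^ e k) •
        (⊤ : Submodule (IwasawaAlgebra p ⧸ Ideal.span {(PowerSeries.X ^ m + PowerSeries.C (p : ℤ_[p]) : IwasawaAlgebra p)})
          (EisensteinLevel p m (fun j ↦ geomTorsion (W.baseChange K) ((p : ℤ) ^ j)) (k + 1 + 1))))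
  (hπ : letI := IwasawaAlgebra.isLocalRing_quotient_X_pow_add_C p hm
    π ∈ IsLocalRing.maximalIdeal
      (IwasawaAlgebra p ⧸ Ideal.span {(PowerSeries.X ^ m + PowerSeries.C (p : ℤ_[p]) : IwasawaAlgebra p)}))
  (he : ∀ k, e k ≤ e (k + 1))
  (hπX : π = Ideal.Quotient.mk _ PowerSeries.X) (hek : ∀ k, e (k + 1) - e k = m)

/-- **`conj_γ (readout [c]) = readout [c] + readout [[X] • c]`** on representatives of `H¹(K, A_𝔮)` ((B3) rearranged:
`γ` acts on `H¹(K_∞, E[p^∞])[𝔮]` as `1 + T`). [cite: Howard2004HeegnerKolyvagin, §2.2 and proof of Thm. 2.2.10]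
[cite: GreenbergLNM1716, §4 p. 98] -/
theorem conjH1_eisensteinTowerReadout_of {γ : absoluteGaloisGroup K} (hγ : κ.IsTopGenerator γ) (j : ℕ) :
    letI := IwasawaAlgebra.isLocalRing_quotient_X_pow_add_C p hm
    ∀ c : galoisCohomology ((W.eisensteinTower (κ.unitTwist (-1)) hm).ρ j) 1,
      (W.baseChange K).conjH1 p κ.kerSubgroup γ
          (W.eisensteinTowerReadout κ hm π e hkill hker hπ he hπX hek (AddCommGroup.DirectLimit.of _ _ j c)) =
        W.eisensteinTowerReadout κ hm π e hkill hker hπ he hπX hek (AddCommGroup.DirectLimit.of _ _ j c) +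
          W.eisensteinTowerReadout κ hm π e hkill hker hπ he hπX hek
            (AddCommGroup.DirectLimit.of _ _ j
              (scalarMapH1 _ ((W.eisensteinTower (κ.unitTwist (-1)) hm).hlin j)
                (Ideal.Quotient.mk _ (PowerSeries.X : IwasawaAlgebra p)) c)) := by
  letI := IwasawaAlgebra.isLocalRing_quotient_X_pow_add_C p hm
  intro c
  rw [W.eisensteinTowerReadout_of_scalarMapH1_mk_X κ hm π e hkill hker hπ he hπX hek hγ
    ((W.baseChange K).conjH1 p κ.kerSubgroup γ) (fun _ ↦ rfl) j c, add_sub_cancel]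
  rfl

/-- **The readout of `H¹_F(K, A_𝔮)` is `Γ_K`-stable in `H¹(K_∞, E[p^∞])`**: for a tower Selmer structure `F` whose
local conditions are `S_m`-submodules (`hsmul`, Howard Def. 1.1.1 — the field `SatisfiesH.cond_smul`) and every
`σ ∈ Γ_K`, `conj_σ` maps `readout (H¹_F(K, A_𝔮))` into itself: by §1 `conj_σ = conj_{γ^n}` on each class, and
`conj_γ (readout [c]) = readout [c] + readout [[X] • c]` with `[[X] • c] ∈ H¹_F(K, A_𝔮)` again
(`AdicTower.of_scalarMapH1_mem_selmerA`).  Hence the Selmer conditions of `Sel_{p^∞}(E/K_∞)` on this image reduce to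
the chosen place above each `v`. [cite: Howard2004HeegnerKolyvagin, Def. 1.1.1 and §2.2, proof of Thm. 2.2.10]
[cite: GreenbergLNM1716, §1 (p. 60) and §4 p. 98] -/
theorem conjH1_mem_map_eisensteinTowerReadout_selmerA {γ : absoluteGaloisGroup K} (hγ : κ.IsTopGenerator γ)
    (F : letI := IwasawaAlgebra.isLocalRing_quotient_X_pow_add_C p hm
      ∀ k, SelmerStructure ((W.eisensteinTower (κ.unitTwist (-1)) hm).ρ k))
    (hsmul : letI := IwasawaAlgebra.isLocalRing_quotient_X_pow_add_C p hm
      ∀ (k : ℕ) (v : NumberField.Place K)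
        (r : IwasawaAlgebra p ⧸ Ideal.span {(PowerSeries.X ^ m + PowerSeries.C (p : ℤ_[p]) : IwasawaAlgebra p)}),
        (F k v).map (scalarMapH1 (((W.eisensteinTower (κ.unitTwist (-1)) hm).ρ k).toLocal v)
          (((W.eisensteinTower (κ.unitTwist (-1)) hm).hlin k).restrictField _) r) ≤ F k v)
    (σ : absoluteGaloisGroup K) :
    letI := IwasawaAlgebra.isLocalRing_quotient_X_pow_add_C p hm
    ∀ r ∈ (AdicTower.selmerA (W.eisensteinTower (κ.unitTwist (-1)) hm) π e hkill hker hπ he F).map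
        (W.eisensteinTowerReadout κ hm π e hkill hker hπ he hπX hek),
      (W.baseChange K).conjH1 p κ.kerSubgroup σ r ∈
        (AdicTower.selmerA (W.eisensteinTower (κ.unitTwist (-1)) hm) π e hkill hker hπ he F).map
          (W.eisensteinTowerReadout κ hm π e hkill hker hπ he hπX hek) := by
  letI := IwasawaAlgebra.isLocalRing_quotient_X_pow_add_C p hm
  intro r hr
  refine (W.baseChange K).conjH1_mem_of_conjH1_generator_mem κ hγ _ (fun r' hr' ↦ ?_) σ hr
  obtain ⟨a, ha, rfl⟩ := hr'
  obtain ⟨j, c, rfl⟩ := AdicTower.exists_of_eq (W.eisensteinTower (κ.unitTwist (-1)) hm) π e hkill hker hπ he a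
  rw [W.conjH1_eisensteinTowerReadout_of κ hm π e hkill hker hπ he hπX hek hγ j c]
  exact add_mem ⟨_, ha, rfl⟩ ⟨_, AdicTower.of_scalarMapH1_mem_selmerA _ π e hkill hker hπ he F hsmul j _ c ha, rfl⟩

end Readout

end WeierstrassCurve
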